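import Summits.KontsevichZagierPeriods.KontsevichZagierPeriods.Theorems.HyperbolicBlochOffTetraSectorKernelStubBakerEnvelopeAux

/-!
# Stub `stub_bakerEnvelope` — crux `OffTetraSectorKernel`, line `odd-hyperbolic-ladder` (skeleton v7, lead c5)

THE WEIGHT-ONE ENVELOPE THEOREM (Baker glues the closed sectors). Granted the five move-lemmas of skeleton v7
(polygons → standard triangles, flattening of a standard triangle, the Weierstrass substitution, the volume of the
corner simplex, the area of the disc — all taken here as HYPOTHESES, exactly as registered), every formal
`ℤ`-combination of rung-0 and rung-1 polytope representations of the hyperbolic ladder, algebraic affine images of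
corner simplices and of the unit disc (integrand `1`) and rational representations of dimension `≤ 1` whose value
vanishes is a Kontsevich–Zagier relation. Proof: every generator class is a MIXED NORMAL FORM
`[pt, r] + Σ Λ(uⱼ, cⱼ) + Σ T(t_l, d_l)` of the HurwitzMicroSectors `NormalFormPrinciple` line (`PiBox.Dlog`), mixed
normal forms are closed under sums and negatives, and a mixed normal form of value `0` is `0` modulo relations by
Baker's theorem (`PiBox.Dlog.nfD_eq_zero_of_eval_eq_zero`, resting on `baker_holds`).

References: A. Baker, *Transcendental Number Theory* (1975), Thm. 2.1; M. Kontsevich, D. Zagier, *Periods* (2001), §1.2.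
-/

noncomputable section

open Set MeasureTheory
open Literature.NumberTheory.Transcendental Literature.NumberTheory.Transcendental.KZ
open Literature.ModelTheory.ExponentialFields (IsSemialgebraic isSemialgebraic_univ isSemialgebraic_setOf_eval_pos
  isSemialgebraic_setOf_eval_lt)
open Summit.KontsevichZagierPeriods.HurwitzMicroSectors.NormalFormPrinciple.PiBox
open Summit.KontsevichZagierPeriods.HurwitzMicroSectors.NormalFormPrinciple.PiBox.Dlog

namespace Summit.KontsevichZagierPeriods.HyperbolicBloch.OffTetraSectorKernel

variable {RA : ℝ → ℝ → ℝ → IntegralRep 1} {ZA : ℝ → IntegralRep 0} {RG : ℝ → ℝ → IntegralRep 1}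

/-! ## Standard doubly-ideal triangles are mixed normal forms -/

/-- **`[Std γ]` is an arctangent carrier** for algebraic `γ ∈ (−1, 1)`: flattening (`stub_stdFlatten`) followed by the
Weierstrass substitution (`stub_arcWeierstrass`) gives `[Std γ] ≡ T(√((1−γ)/(1+γ)), 2)`, a mixed normal form.
[cite: KontsevichZagier2001, §1.2 rules (2), (3)] -/
theorem env_nfD_std_open
    (hZ : ∀ r, IsAlgebraic ℚ r → (ZA r).domain = univ ∧ (ZA r).integrand = fun _ => r)
    (hRG : ∀ t d, IsAlgebraic ℚ t → IsAlgebraic ℚ d →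
      (RG t d).domain = {x | x 0 ∈ Set.Ioo 0 t} ∧ (RG t d).integrand = fun x => d / (1 + x 0 ^ 2))
    (hFlat : ∀ γ : ℝ, IsAlgebraic ℚ γ → -1 < γ → γ < 1 →
      ∀ (S : IntegralRep 2), S.domain = {p | γ < p 0 ∧ p 0 < 1 ∧ 0 < p 1 ∧ 1 < (p 0 - 0) ^ 2 + p 1 ^ 2} →
        EqOn S.integrand (fun p => 1 / p 1 ^ 2) S.domain →
        (∃ A : IntegralRep 1, A.domain = {x | x 0 ∈ Ioo γ 1} ∧
          A.integrand = fun x => 1 / Real.sqrt (1 - x 0 ^ 2)) ∧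
        (∀ A : IntegralRep 1, A.domain = {x | x 0 ∈ Ioo γ 1} →
          (A.integrand = fun x => 1 / Real.sqrt (1 - x 0 ^ 2)) → of S - of A ∈ relations))
    (hW : ∀ γ : ℝ, IsAlgebraic ℚ γ → -1 < γ → γ < 1 →
      ∀ (A : IntegralRep 1), A.domain = {x | x 0 ∈ Ioo γ 1} →
        (A.integrand = fun x => 1 / Real.sqrt (1 - x 0 ^ 2)) →
      ∀ (L : IntegralRep 1), L.domain = {x | x 0 ∈ Ioo 0 (Real.sqrt ((1 - γ) / (1 + γ)))} →
        (L.integrand = fun x => 2 / (1 + x 0 ^ 2)) → of A - of L ∈ relations)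
    {γ : ℝ} (hγ : IsAlgebraic ℚ γ) (h1 : -1 < γ) (h2 : γ < 1) (S : IntegralRep 2)
    (hSd : S.domain = {p | γ < p 0 ∧ p 0 < 1 ∧ 0 < p 1 ∧ 1 < (p 0 - 0) ^ 2 + p 1 ^ 2})
    (hSi : EqOn S.integrand (fun p => 1 / p 1 ^ 2) S.domain) :
    ∃ (r : ℝ) (k : ℕ) (u c : Fin k → ℝ) (k' : ℕ) (t d : Fin k' → ℝ), IsAlgebraic ℚ r ∧ (∀ j, 1 < u j) ∧
      (∀ j, IsAlgebraic ℚ (u j)) ∧ (∀ j, IsAlgebraic ℚ (c j)) ∧ (∀ l, 0 ≤ t l) ∧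
      (∀ l, IsAlgebraic ℚ (t l)) ∧ (∀ l, IsAlgebraic ℚ (d l)) ∧
      QuotientAddGroup.mk' relations (of S) = QuotientAddGroup.mk' relations (of (ZA r)) +
        ∑ j, QuotientAddGroup.mk' relations (of (RA 1 (u j) (c j))) +
        ∑ l, QuotientAddGroup.mk' relations (of (RG (t l) (d l))) := by
  obtain ⟨⟨A, hAd, hAi⟩, hSA⟩ := hFlat γ hγ h1 h2 S hSd hSi
  have e1 : of S - of A ∈ relations := hSA A hAd hAi
  have htA : IsAlgebraic ℚ (Real.sqrt ((1 - γ) / (1 + γ))) := by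
    refine rungZero_isAlgebraic_sqrt ?_
    rw [div_eq_mul_inv]
    exact (isAlgebraic_one.sub hγ).mul (isAlgebraic_one.add hγ).inv
  obtain ⟨hLd, hLi⟩ := hRG _ 2 htA isAlgebraic_two
  have e2 : of A - of (RG (Real.sqrt ((1 - γ) / (1 + γ))) 2) ∈ relations :=
    hW γ hγ h1 h2 A hAd hAi _ hLd hLi
  have e : of S - of (RG (Real.sqrt ((1 - γ) / (1 + γ))) 2) ∈ relations := by
    have := relations.add_mem e1 e2
    rwa [sub_add_sub_cancel] at this
  rw [K22.mk_eq_mk_of_sub_mem e]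
  exact env_nfD_carrierG hZ htA isAlgebraic_two (Real.sqrt_nonneg _)

/-- **`[Std γ]` is a mixed normal form** for every algebraic `γ ∈ [−1, 1]`: the open case is
`env_nfD_std_open`; `Std 1 = ∅`; and `[Std (−1)] ≡ 2[Std 0] + [Std 1]` by the three-triangle relation
(`stub_threeTriangles` with `a = b = 0`). [cite: KontsevichZagier2001, §1.2] -/
theorem env_nfD_std
    (hZ : ∀ r, IsAlgebraic ℚ r → (ZA r).domain = univ ∧ (ZA r).integrand = fun _ => r)
    (hRG : ∀ t d, IsAlgebraic ℚ t → IsAlgebraic ℚ d →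
      (RG t d).domain = {x | x 0 ∈ Set.Ioo 0 t} ∧ (RG t d).integrand = fun x => d / (1 + x 0 ^ 2))
    (hFlat : ∀ γ : ℝ, IsAlgebraic ℚ γ → -1 < γ → γ < 1 →
      ∀ (S : IntegralRep 2), S.domain = {p | γ < p 0 ∧ p 0 < 1 ∧ 0 < p 1 ∧ 1 < (p 0 - 0) ^ 2 + p 1 ^ 2} →
        EqOn S.integrand (fun p => 1 / p 1 ^ 2) S.domain →
        (∃ A : IntegralRep 1, A.domain = {x | x 0 ∈ Ioo γ 1} ∧
          A.integrand = fun x => 1 / Real.sqrt (1 - x 0 ^ 2)) ∧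
        (∀ A : IntegralRep 1, A.domain = {x | x 0 ∈ Ioo γ 1} →
          (A.integrand = fun x => 1 / Real.sqrt (1 - x 0 ^ 2)) → of S - of A ∈ relations))
    (hW : ∀ γ : ℝ, IsAlgebraic ℚ γ → -1 < γ → γ < 1 →
      ∀ (A : IntegralRep 1), A.domain = {x | x 0 ∈ Ioo γ 1} →
        (A.integrand = fun x => 1 / Real.sqrt (1 - x 0 ^ 2)) →
      ∀ (L : IntegralRep 1), L.domain = {x | x 0 ∈ Ioo 0 (Real.sqrt ((1 - γ) / (1 + γ)))} →
        (L.integrand = fun x => 2 / (1 + x 0 ^ 2)) → of A - of L ∈ relations)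
    {γ : ℝ} (hγ : IsAlgebraic ℚ γ) (h1 : -1 ≤ γ) (h2 : γ ≤ 1) (S : IntegralRep 2)
    (hSd : S.domain = {p | γ < p 0 ∧ p 0 < 1 ∧ 0 < p 1 ∧ 1 < (p 0 - 0) ^ 2 + p 1 ^ 2})
    (hSi : EqOn S.integrand (fun p => 1 / p 1 ^ 2) S.domain) :
    ∃ (r : ℝ) (k : ℕ) (u c : Fin k → ℝ) (k' : ℕ) (t d : Fin k' → ℝ), IsAlgebraic ℚ r ∧ (∀ j, 1 < u j) ∧
      (∀ j, IsAlgebraic ℚ (u j)) ∧ (∀ j, IsAlgebraic ℚ (c j)) ∧ (∀ l, 0 ≤ t l) ∧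
      (∀ l, IsAlgebraic ℚ (t l)) ∧ (∀ l, IsAlgebraic ℚ (d l)) ∧
      QuotientAddGroup.mk' relations (of S) = QuotientAddGroup.mk' relations (of (ZA r)) +
        ∑ j, QuotientAddGroup.mk' relations (of (RA 1 (u j) (c j))) +
        ∑ l, QuotientAddGroup.mk' relations (of (RG (t l) (d l))) := by
  classical
  rcases h2.lt_or_eq with h2 | h2
  · rcases h1.lt_or_eq with h1 | h1
    · exact env_nfD_std_open hZ hRG hFlat hW hγ h1 h2 S hSd hSi
    · -- `γ = -1`: three-triangle relation with `a = b = 0`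
      subst h1
      set V : ℝ → ℝ → ℝ → ℝ → Set (Fin 2 → ℝ) := fun α β a c =>
        {p | α < p 0 ∧ p 0 < β ∧ 0 < p 1 ∧ c < (p 0 - a) ^ 2 + p 1 ^ 2} with hVdef
      have hV : ∀ α β a c, V α β a c = {p | α < p 0 ∧ p 0 < β ∧ 0 < p 1 ∧ c < (p 0 - a) ^ 2 + p 1 ^ 2} :=
        fun _ _ _ _ => rfl
      obtain ⟨r0, hr0d, hr0i⟩ := (stub_vPiece V hV).1 0 1 0 1 isAlgebraic_zero isAlgebraic_one isAlgebraic_zero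
        isAlgebraic_one one_pos (by norm_num) (by norm_num)
      have hsq : Real.sqrt (1 - (0:ℝ) ^ 2) * Real.sqrt (1 - (0:ℝ) ^ 2) - 0 * 0 = 1 := by simp
      have hcd : (KZ.IntegralRep.empty 2).domain =
          V (Real.sqrt (1 - (0:ℝ) ^ 2) * Real.sqrt (1 - (0:ℝ) ^ 2) - 0 * 0) 1 0 1 := by
        rw [hsq, KZ.IntegralRep.domain_empty, hV]
        ext p
        simp only [mem_empty_iff_false, mem_setOf_eq, false_iff, not_and]
        intro hp1 hp2
        linarith
      have hT := stub_threeTriangles V hV (stub_vPiece V hV).1 0 0 isAlgebraic_zero isAlgebraic_zero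
        (by norm_num) (by norm_num) (by norm_num) (by norm_num) (by norm_num) r0 r0 (KZ.IntegralRep.empty 2) S
        hr0d (fun p _ => by rw [hr0i]) hr0d (fun p _ => by rw [hr0i]) hcd
        (fun p hp => absurd hp (by simp [KZ.IntegralRep.domain_empty])) (by rw [hSd, hV]) hSi
      have hempty : of (KZ.IntegralRep.empty 2) ∈ relations :=
        of_mem_relations_of_volume_eq_zero _ (by simp [KZ.IntegralRep.domain_empty])
      have hcls : QuotientAddGroup.mk' relations (of S) =
          QuotientAddGroup.mk' relations (of r0) + QuotientAddGroup.mk' relations (of r0) := by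
        have h := K22.mk_eq_mk_of_sub_mem hT
        have h0 : QuotientAddGroup.mk' relations (of (KZ.IntegralRep.empty 2)) = 0 :=
          (QuotientAddGroup.eq_zero_iff _).mpr hempty
        rw [map_add, map_add, h0, add_zero] at h
        exact h.symm
      rw [hcls]
      have h0 := env_nfD_std_open (RA := RA) hZ hRG hFlat hW isAlgebraic_zero (by norm_num) (by norm_num) r0
        (by rw [hr0d, hV]) (fun p _ => by rw [hr0i])
      exact nfD_add hZ h0 h0
  · -- `γ = 1`: the domain is empty
    subst h2
    have hempty : of S ∈ relations := by
      refine of_mem_relations_of_volume_eq_zero _ ?_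
      have : S.domain = ∅ := by
        rw [hSd]
        ext p
        simp only [mem_setOf_eq, mem_empty_iff_false, iff_false, not_and]
        intro hp1 hp2
        linarith
      rw [this, measure_empty]
    have h0 : QuotientAddGroup.mk' relations (of S) = 0 := (QuotientAddGroup.eq_zero_iff _).mpr hempty
    rw [h0]
    exact nfD_zero hZ

/-! ## Hyperbolic areas are mixed normal forms -/

/-- **Rung-1 polytope representations are mixed normal forms** (`stub_rungOneStd` + `env_nfD_std`).
[cite: KontsevichZagier2001, §1.2] -/
theorem env_nfD_polygon
    (hR : ∀ a b c, IsAlgebraic ℚ a → IsAlgebraic ℚ b → IsAlgebraic ℚ c → 0 < a →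
      (RA a b c).domain = {x | x 0 ∈ Set.Ioo a b} ∧ (RA a b c).integrand = fun x => c / x 0)
    (hZ : ∀ r, IsAlgebraic ℚ r → (ZA r).domain = univ ∧ (ZA r).integrand = fun _ => r)
    (hRG : ∀ t d, IsAlgebraic ℚ t → IsAlgebraic ℚ d →
      (RG t d).domain = {x | x 0 ∈ Set.Ioo 0 t} ∧ (RG t d).integrand = fun x => d / (1 + x 0 ^ 2))
    (hStd : ∀ (N : IntegralRep 2), IsGeodesicPolytope 1 N.domain →
      EqOn N.integrand (fun p => 1 / p 1 ^ 2) N.domain →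
      ∃ (m : ℕ) (γ δ : Fin m → ℝ) (s : Fin m → ℤ) (Sγ Sδ : Fin m → IntegralRep 2),
        (∀ j, IsAlgebraic ℚ (γ j) ∧ -1 ≤ γ j ∧ γ j ≤ 1 ∧ IsAlgebraic ℚ (δ j) ∧ -1 ≤ δ j ∧ δ j ≤ 1) ∧
        (∀ j, (Sγ j).domain = {p | γ j < p 0 ∧ p 0 < 1 ∧ 0 < p 1 ∧ 1 < (p 0 - 0) ^ 2 + p 1 ^ 2} ∧
          EqOn (Sγ j).integrand (fun p => 1 / p 1 ^ 2) (Sγ j).domain) ∧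
        (∀ j, (Sδ j).domain = {p | δ j < p 0 ∧ p 0 < 1 ∧ 0 < p 1 ∧ 1 < (p 0 - 0) ^ 2 + p 1 ^ 2} ∧
          EqOn (Sδ j).integrand (fun p => 1 / p 1 ^ 2) (Sδ j).domain) ∧
        of N - ∑ j, s j • (of (Sγ j) - of (Sδ j)) ∈ relations)
    (hFlat : ∀ γ : ℝ, IsAlgebraic ℚ γ → -1 < γ → γ < 1 →
      ∀ (S : IntegralRep 2), S.domain = {p | γ < p 0 ∧ p 0 < 1 ∧ 0 < p 1 ∧ 1 < (p 0 - 0) ^ 2 + p 1 ^ 2} →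
        EqOn S.integrand (fun p => 1 / p 1 ^ 2) S.domain →
        (∃ A : IntegralRep 1, A.domain = {x | x 0 ∈ Ioo γ 1} ∧
          A.integrand = fun x => 1 / Real.sqrt (1 - x 0 ^ 2)) ∧
        (∀ A : IntegralRep 1, A.domain = {x | x 0 ∈ Ioo γ 1} →
          (A.integrand = fun x => 1 / Real.sqrt (1 - x 0 ^ 2)) → of S - of A ∈ relations))
    (hW : ∀ γ : ℝ, IsAlgebraic ℚ γ → -1 < γ → γ < 1 →
      ∀ (A : IntegralRep 1), A.domain = {x | x 0 ∈ Ioo γ 1} →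
        (A.integrand = fun x => 1 / Real.sqrt (1 - x 0 ^ 2)) →
      ∀ (L : IntegralRep 1), L.domain = {x | x 0 ∈ Ioo 0 (Real.sqrt ((1 - γ) / (1 + γ)))} →
        (L.integrand = fun x => 2 / (1 + x 0 ^ 2)) → of A - of L ∈ relations)
    (N : IntegralRep 2) (hP : IsGeodesicPolytope 1 N.domain) (hri : EqOn N.integrand (hypDensity 1) N.domain) :
    ∃ (r : ℝ) (k : ℕ) (u c : Fin k → ℝ) (k' : ℕ) (t d : Fin k' → ℝ), IsAlgebraic ℚ r ∧ (∀ j, 1 < u j) ∧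
      (∀ j, IsAlgebraic ℚ (u j)) ∧ (∀ j, IsAlgebraic ℚ (c j)) ∧ (∀ l, 0 ≤ t l) ∧
      (∀ l, IsAlgebraic ℚ (t l)) ∧ (∀ l, IsAlgebraic ℚ (d l)) ∧
      QuotientAddGroup.mk' relations (of N) = QuotientAddGroup.mk' relations (of (ZA r)) +
        ∑ j, QuotientAddGroup.mk' relations (of (RA 1 (u j) (c j))) +
        ∑ l, QuotientAddGroup.mk' relations (of (RG (t l) (d l))) := by
  classical
  have hdens : EqOn N.integrand (fun p => 1 / p 1 ^ 2) N.domain := fun p hp => by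
    rw [hri hp]
    simp [hypDensity, Fin.last]
  obtain ⟨m, γ, δ, s, Sγ, Sδ, hdata, hSγ, hSδ, hrel⟩ := hStd N hP hdens
  have hcls : QuotientAddGroup.mk' relations (of N) =
      ∑ j ∈ Finset.univ, s j • (QuotientAddGroup.mk' relations (of (Sγ j)) +
        -QuotientAddGroup.mk' relations (of (Sδ j))) := by
    have h := K22.mk_eq_mk_of_sub_mem hrel
    rw [h, map_sum]
    refine Finset.sum_congr rfl fun j _ => ?_
    rw [map_zsmul, map_sub, sub_eq_add_neg]
  rw [hcls]
  refine env_nfD_sum_zsmul hR hZ hRG _ s _ fun j _ => ?_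
  obtain ⟨hγa, hγ1, hγ2, hδa, hδ1, hδ2⟩ := hdata j
  exact nfD_add hZ (env_nfD_std hZ hRG hFlat hW hγa hγ1 hγ2 (Sγ j) (hSγ j).1 (hSγ j).2)
    (nfD_neg hR hZ hRG (env_nfD_std hZ hRG hFlat hW hδa hδ1 hδ2 (Sδ j) (hSδ j).1 (hSδ j).2))


/-! ## Every element of the weight-one envelope is a mixed normal form, and its value -/

/-- **Every element of the weight-one envelope is a mixed normal form** (closure induction over the five kinds of
generators; granted the five move-lemmas of skeleton v7 as hypotheses). [cite: KontsevichZagier2001, §1.2] -/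
theorem env_nfD_of_mem_closure
    (hR : ∀ a b c, IsAlgebraic ℚ a → IsAlgebraic ℚ b → IsAlgebraic ℚ c → 0 < a →
      (RA a b c).domain = {x | x 0 ∈ Set.Ioo a b} ∧ (RA a b c).integrand = fun x => c / x 0)
    (hZ : ∀ r, IsAlgebraic ℚ r → (ZA r).domain = univ ∧ (ZA r).integrand = fun _ => r)
    (hRG : ∀ t d, IsAlgebraic ℚ t → IsAlgebraic ℚ d →
      (RG t d).domain = {x | x 0 ∈ Set.Ioo 0 t} ∧ (RG t d).integrand = fun x => d / (1 + x 0 ^ 2))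
    (hStd : ∀ (N : IntegralRep 2), IsGeodesicPolytope 1 N.domain →
      EqOn N.integrand (fun p => 1 / p 1 ^ 2) N.domain →
      ∃ (m : ℕ) (γ δ : Fin m → ℝ) (s : Fin m → ℤ) (Sγ Sδ : Fin m → IntegralRep 2),
        (∀ j, IsAlgebraic ℚ (γ j) ∧ -1 ≤ γ j ∧ γ j ≤ 1 ∧ IsAlgebraic ℚ (δ j) ∧ -1 ≤ δ j ∧ δ j ≤ 1) ∧
        (∀ j, (Sγ j).domain = {p | γ j < p 0 ∧ p 0 < 1 ∧ 0 < p 1 ∧ 1 < (p 0 - 0) ^ 2 + p 1 ^ 2} ∧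
          EqOn (Sγ j).integrand (fun p => 1 / p 1 ^ 2) (Sγ j).domain) ∧
        (∀ j, (Sδ j).domain = {p | δ j < p 0 ∧ p 0 < 1 ∧ 0 < p 1 ∧ 1 < (p 0 - 0) ^ 2 + p 1 ^ 2} ∧
          EqOn (Sδ j).integrand (fun p => 1 / p 1 ^ 2) (Sδ j).domain) ∧
        of N - ∑ j, s j • (of (Sγ j) - of (Sδ j)) ∈ relations)
    (hFlat : ∀ γ : ℝ, IsAlgebraic ℚ γ → -1 < γ → γ < 1 →
      ∀ (S : IntegralRep 2), S.domain = {p | γ < p 0 ∧ p 0 < 1 ∧ 0 < p 1 ∧ 1 < (p 0 - 0) ^ 2 + p 1 ^ 2} →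
        EqOn S.integrand (fun p => 1 / p 1 ^ 2) S.domain →
        (∃ A : IntegralRep 1, A.domain = {x | x 0 ∈ Ioo γ 1} ∧
          A.integrand = fun x => 1 / Real.sqrt (1 - x 0 ^ 2)) ∧
        (∀ A : IntegralRep 1, A.domain = {x | x 0 ∈ Ioo γ 1} →
          (A.integrand = fun x => 1 / Real.sqrt (1 - x 0 ^ 2)) → of S - of A ∈ relations))
    (hW : ∀ γ : ℝ, IsAlgebraic ℚ γ → -1 < γ → γ < 1 →
      ∀ (A : IntegralRep 1), A.domain = {x | x 0 ∈ Ioo γ 1} →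
        (A.integrand = fun x => 1 / Real.sqrt (1 - x 0 ^ 2)) →
      ∀ (L : IntegralRep 1), L.domain = {x | x 0 ∈ Ioo 0 (Real.sqrt ((1 - γ) / (1 + γ)))} →
        (L.integrand = fun x => 2 / (1 + x 0 ^ 2)) → of A - of L ∈ relations)
    (hSimp : ∀ (d : ℕ) (c : ℝ), IsAlgebraic ℚ c →
      ∀ (S : IntegralRep d), S.domain = {x | (∀ i, 0 < x i) ∧ ∑ i, x i < 1} →
        (∀ x ∈ S.domain, S.integrand x = c) →
      ∀ (Z : IntegralRep 0), Z.domain = univ → (Z.integrand = fun _ => c / (Nat.factorial d : ℝ)) →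
        of S - of Z ∈ relations)
    (hDisc : ∀ (c : ℝ), IsAlgebraic ℚ c →
      ∀ (D : IntegralRep 2), D.domain = {p | p 0 ^ 2 + p 1 ^ 2 < 1} → (∀ p ∈ D.domain, D.integrand p = c) →
      ∀ (L : IntegralRep 1), L.domain = {x | x 0 ∈ Ioo 0 1} →
        (L.integrand = fun x => 4 * c / (1 + x 0 ^ 2)) → of D - of L ∈ relations)
    {x : FormalRep} (hx : x ∈ AddSubgroup.closure
      ({y : FormalRep | ∃ r : IntegralRep 1, IsGeodesicPolytope 0 r.domain ∧
          EqOn r.integrand (hypDensity 0) r.domain ∧ y = of r} ∪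
        {y | ∃ r : IntegralRep 2, IsGeodesicPolytope 1 r.domain ∧
          EqOn r.integrand (hypDensity 1) r.domain ∧ y = of r} ∪
        {y | ∃ (d : ℕ) (A : Matrix (Fin d) (Fin d) ℝ) (b : Fin d → ℝ) (r : IntegralRep d),
          (∀ j l, IsAlgebraic ℚ (A j l)) ∧ (∀ j, IsAlgebraic ℚ (b j)) ∧ A.det ≠ 0 ∧
          r.domain = (fun x => A.mulVec x + b) '' {x | (∀ i, 0 < x i) ∧ ∑ i, x i < 1} ∧
          (∀ x ∈ r.domain, r.integrand x = 1) ∧ y = of r} ∪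
        {y | ∃ (A : Matrix (Fin 2) (Fin 2) ℝ) (b : Fin 2 → ℝ) (r : IntegralRep 2),
          (∀ j l, IsAlgebraic ℚ (A j l)) ∧ (∀ j, IsAlgebraic ℚ (b j)) ∧ A.det ≠ 0 ∧
          r.domain = (fun x => A.mulVec x + b) '' {p | p 0 ^ 2 + p 1 ^ 2 < 1} ∧
          (∀ x ∈ r.domain, r.integrand x = 1) ∧ y = of r} ∪
        {y | ∃ (m : ℕ) (N : IntegralRep m), m ≤ 1 ∧ N.IsRational ∧ y = of N})) :
    ∃ (r : ℝ) (k : ℕ) (u c : Fin k → ℝ) (k' : ℕ) (t d : Fin k' → ℝ), IsAlgebraic ℚ r ∧ (∀ j, 1 < u j) ∧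
      (∀ j, IsAlgebraic ℚ (u j)) ∧ (∀ j, IsAlgebraic ℚ (c j)) ∧ (∀ l, 0 ≤ t l) ∧
      (∀ l, IsAlgebraic ℚ (t l)) ∧ (∀ l, IsAlgebraic ℚ (d l)) ∧
      QuotientAddGroup.mk' relations x = QuotientAddGroup.mk' relations (of (ZA r)) +
        ∑ j, QuotientAddGroup.mk' relations (of (RA 1 (u j) (c j))) +
        ∑ l, QuotientAddGroup.mk' relations (of (RG (t l) (d l))) := by
  classical
  induction hx using AddSubgroup.closure_induction with
  | mem y hy =>
    rcases hy with (((hy | hy) | hy) | hy) | hy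
    · obtain ⟨r, hP, hri, rfl⟩ := hy
      exact env_nfD_rungZero hR hZ hRG r hP hri
    · obtain ⟨r, hP, hri, rfl⟩ := hy
      exact env_nfD_polygon hR hZ hRG hStd hFlat hW r hP hri
    · obtain ⟨d, A, b, r, hA, hb, hdet, hdom, hone, rfl⟩ := hy
      exact env_nfD_simplexImage (RA := RA) (RG := RG) hZ hSimp hA hb hdet r hdom hone
    · obtain ⟨A, b, r, hA, hb, hdet, hdom, hone, rfl⟩ := hy
      exact env_nfD_discImage (RA := RA) hZ hRG hDisc hA hb hdet r hdom hone
    · obtain ⟨m, N, hm, hN, rfl⟩ := hy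
      exact nfD_of_isRational_dim_le_one hR hZ hRG hm N hN
  | zero => rw [map_zero]; exact nfD_zero hZ
  | add y z _ _ ihy ihz => rw [map_add]; exact nfD_add hZ ihy ihz
  | neg y _ ih => rw [map_neg]; exact nfD_neg hR hZ hRG ih

/-- **The value of a mixed normal form**: if `[x] = [pt, r] + Σ Λ(uⱼ, cⱼ) + Σ T(t_l, d_l)` then
`eval x = r + Σ cⱼ log uⱼ + Σ d_l arctan t_l`. [cite: KontsevichZagier2001, §1.1] -/
theorem env_eval_of_nfD
    (hR : ∀ a b c, IsAlgebraic ℚ a → IsAlgebraic ℚ b → IsAlgebraic ℚ c → 0 < a →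
      (RA a b c).domain = {x | x 0 ∈ Set.Ioo a b} ∧ (RA a b c).integrand = fun x => c / x 0)
    (hZ : ∀ r, IsAlgebraic ℚ r → (ZA r).domain = univ ∧ (ZA r).integrand = fun _ => r)
    (hRG : ∀ t d, IsAlgebraic ℚ t → IsAlgebraic ℚ d →
      (RG t d).domain = {x | x 0 ∈ Set.Ioo 0 t} ∧ (RG t d).integrand = fun x => d / (1 + x 0 ^ 2))
    {x : FormalRep} {r : ℝ} {k : ℕ} {u c : Fin k → ℝ} {k' : ℕ} {t d : Fin k' → ℝ}
    (hr : IsAlgebraic ℚ r) (hu1 : ∀ j, 1 < u j) (hu : ∀ j, IsAlgebraic ℚ (u j)) (hc : ∀ j, IsAlgebraic ℚ (c j))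
    (ht0 : ∀ l, 0 ≤ t l) (ht : ∀ l, IsAlgebraic ℚ (t l)) (hd : ∀ l, IsAlgebraic ℚ (d l))
    (hx : QuotientAddGroup.mk' relations x = QuotientAddGroup.mk' relations (of (ZA r)) +
      ∑ j, QuotientAddGroup.mk' relations (of (RA 1 (u j) (c j))) +
      ∑ l, QuotientAddGroup.mk' relations (of (RG (t l) (d l)))) :
    eval x = r + ∑ j, c j * Real.log (u j) + ∑ l, d l * Real.arctan (t l) := by
  have hrep : x - (of (ZA r) + ∑ j, of (RA 1 (u j) (c j)) + ∑ l, of (RG (t l) (d l))) ∈ relations := by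
    rw [← QuotientAddGroup.eq_zero_iff]
    change QuotientAddGroup.mk' relations _ = 0
    rw [map_sub, sub_eq_zero, hx, map_add, map_add, map_sum, map_sum]
  have h := relations_le_ker_eval_holds hrep
  rw [AddMonoidHom.mem_ker, map_sub, sub_eq_zero] at h
  rw [h, map_add, map_add, map_sum, map_sum, eval_of, value_pt (ZA r) (hZ r hr).1 (hZ r hr).2]
  congr 1
  · congr 1
    refine Finset.sum_congr rfl fun j _ => ?_
    obtain ⟨hdj, hij⟩ := hR 1 (u j) (c j) isAlgebraic_one (hu j) (hc j) one_pos
    rw [eval_of, value_dlogA (RA 1 (u j) (c j)) hdj (by rw [hij]; exact fun _ _ => rfl) one_pos (hu1 j).le, div_one]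
  · refine Finset.sum_congr rfl fun l _ => ?_
    obtain ⟨hdl, hil⟩ := hRG (t l) (d l) (ht l) (hd l)
    rw [eval_of, value_angA (RG (t l) (d l)) hdl (by rw [hil]; exact fun _ _ => rfl) (ht0 l), Real.arctan_zero,
      sub_zero]

/-! ## The registered stub -/

/-- **STUB `stub_bakerEnvelope`** (lead, skeleton v7 of line `odd-hyperbolic-ladder`): THE WEIGHT-ONE ENVELOPE
THEOREM. Granted the five move-lemmas (the registered statements of `stub_rungOneStd`, `stub_stdFlatten`,
`stub_arcWeierstrass`, `stub_cornerSimplexClass`, `stub_discClass`), every formal `ℤ`-combination of rung-0 and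
rung-1 polytope representations, algebraic affine images of corner simplices (integrand `1`, any dimension),
algebraic affine images of the unit disc (integrand `1`) and rational representations of dimension `≤ 1`, whose
value vanishes, is a Kontsevich–Zagier relation: every generator class is a mixed normal form (lemmas above), mixed
normal forms are closed under sums and negatives (`PiBox.Dlog.nfD_add`, `nfD_neg`), and a mixed normal form of
value `0` is `0` by Baker's theorem (`PiBox.Dlog.nfD_eq_zero_of_eval_eq_zero`, `baker_holds`).
[cite: Baker1975, Theorem 2.1] -/
theorem stub_bakerEnvelope :
    (∀ (r : KZ.IntegralRep 2), KZ.IsGeodesicPolytope 1 r.domain →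
      EqOn r.integrand (fun p => 1 / p 1 ^ 2) r.domain →
      ∃ (m : ℕ) (γ δ : Fin m → ℝ) (s : Fin m → ℤ) (Sγ Sδ : Fin m → KZ.IntegralRep 2),
        (∀ j, IsAlgebraic ℚ (γ j) ∧ -1 ≤ γ j ∧ γ j ≤ 1 ∧ IsAlgebraic ℚ (δ j) ∧ -1 ≤ δ j ∧ δ j ≤ 1) ∧
        (∀ j, (Sγ j).domain = {p | γ j < p 0 ∧ p 0 < 1 ∧ 0 < p 1 ∧ 1 < (p 0 - 0) ^ 2 + p 1 ^ 2} ∧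
          EqOn (Sγ j).integrand (fun p => 1 / p 1 ^ 2) (Sγ j).domain) ∧
        (∀ j, (Sδ j).domain = {p | δ j < p 0 ∧ p 0 < 1 ∧ 0 < p 1 ∧ 1 < (p 0 - 0) ^ 2 + p 1 ^ 2} ∧
          EqOn (Sδ j).integrand (fun p => 1 / p 1 ^ 2) (Sδ j).domain) ∧
        KZ.of r - ∑ j, s j • (KZ.of (Sγ j) - KZ.of (Sδ j)) ∈ KZ.relations) →
    (∀ γ : ℝ, IsAlgebraic ℚ γ → -1 < γ → γ < 1 →
      ∀ (S : KZ.IntegralRep 2), S.domain = {p | γ < p 0 ∧ p 0 < 1 ∧ 0 < p 1 ∧ 1 < (p 0 - 0) ^ 2 + p 1 ^ 2} →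
        EqOn S.integrand (fun p => 1 / p 1 ^ 2) S.domain →
        (∃ A : KZ.IntegralRep 1, A.domain = {x | x 0 ∈ Ioo γ 1} ∧
          A.integrand = fun x => 1 / Real.sqrt (1 - x 0 ^ 2)) ∧
        (∀ A : KZ.IntegralRep 1, A.domain = {x | x 0 ∈ Ioo γ 1} →
          (A.integrand = fun x => 1 / Real.sqrt (1 - x 0 ^ 2)) → KZ.of S - KZ.of A ∈ KZ.relations)) →
    (∀ γ : ℝ, IsAlgebraic ℚ γ → -1 < γ → γ < 1 →
      ∀ (A : KZ.IntegralRep 1), A.domain = {x | x 0 ∈ Ioo γ 1} →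
        (A.integrand = fun x => 1 / Real.sqrt (1 - x 0 ^ 2)) →
      ∀ (L : KZ.IntegralRep 1), L.domain = {x | x 0 ∈ Ioo 0 (Real.sqrt ((1 - γ) / (1 + γ)))} →
        (L.integrand = fun x => 2 / (1 + x 0 ^ 2)) → KZ.of A - KZ.of L ∈ KZ.relations) →
    (∀ (d : ℕ) (c : ℝ), IsAlgebraic ℚ c →
      ∀ (S : KZ.IntegralRep d), S.domain = {x | (∀ i, 0 < x i) ∧ ∑ i, x i < 1} →
        (∀ x ∈ S.domain, S.integrand x = c) →
      ∀ (Z : KZ.IntegralRep 0), Z.domain = univ → (Z.integrand = fun _ => c / (Nat.factorial d : ℝ)) →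
        KZ.of S - KZ.of Z ∈ KZ.relations) →
    (∀ (c : ℝ), IsAlgebraic ℚ c →
      ∀ (D : KZ.IntegralRep 2), D.domain = {p | p 0 ^ 2 + p 1 ^ 2 < 1} → (∀ p ∈ D.domain, D.integrand p = c) →
      ∀ (L : KZ.IntegralRep 1), L.domain = {x | x 0 ∈ Ioo 0 1} →
        (L.integrand = fun x => 4 * c / (1 + x 0 ^ 2)) → KZ.of D - KZ.of L ∈ KZ.relations) →
    ∀ x ∈ AddSubgroup.closure
      ({y : KZ.FormalRep | ∃ r : KZ.IntegralRep 1, KZ.IsGeodesicPolytope 0 r.domain ∧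
          EqOn r.integrand (KZ.hypDensity 0) r.domain ∧ y = KZ.of r} ∪
        {y | ∃ r : KZ.IntegralRep 2, KZ.IsGeodesicPolytope 1 r.domain ∧
          EqOn r.integrand (KZ.hypDensity 1) r.domain ∧ y = KZ.of r} ∪
        {y | ∃ (d : ℕ) (A : Matrix (Fin d) (Fin d) ℝ) (b : Fin d → ℝ) (r : KZ.IntegralRep d),
          (∀ j l, IsAlgebraic ℚ (A j l)) ∧ (∀ j, IsAlgebraic ℚ (b j)) ∧ A.det ≠ 0 ∧
          r.domain = (fun x => A.mulVec x + b) '' {x | (∀ i, 0 < x i) ∧ ∑ i, x i < 1} ∧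
          (∀ x ∈ r.domain, r.integrand x = 1) ∧ y = KZ.of r} ∪
        {y | ∃ (A : Matrix (Fin 2) (Fin 2) ℝ) (b : Fin 2 → ℝ) (r : KZ.IntegralRep 2),
          (∀ j l, IsAlgebraic ℚ (A j l)) ∧ (∀ j, IsAlgebraic ℚ (b j)) ∧ A.det ≠ 0 ∧
          r.domain = (fun x => A.mulVec x + b) '' {p | p 0 ^ 2 + p 1 ^ 2 < 1} ∧
          (∀ x ∈ r.domain, r.integrand x = 1) ∧ y = KZ.of r} ∪
        {y | ∃ (m : ℕ) (N : KZ.IntegralRep m), m ≤ 1 ∧ N.IsRational ∧ y = KZ.of N}),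
      KZ.eval x = 0 → x ∈ KZ.relations := by
  intro hStd hFlat hW hSimp hDisc x hx hv
  classical
  obtain ⟨RA, hR⟩ := exists_carrierA
  obtain ⟨ZA, hZ⟩ := exists_ptCarrierA
  obtain ⟨RG, hRG⟩ := exists_angCarrier
  have hNF := env_nfD_of_mem_closure hR hZ hRG hStd hFlat hW hSimp hDisc hx
  obtain ⟨r, k, u, c, k', t, d, hr, hu1, hu, hc, ht0, ht, hd, hEq⟩ := hNF
  exact (QuotientAddGroup.eq_zero_iff _).mp
    (nfD_eq_zero_of_eval_eq_zero hR hZ hRG x hr hu1 hu hc ht0 ht hd hEq hv)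

end Summit.KontsevichZagierPeriods.HyperbolicBloch.OffTetraSectorKernel

end
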